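import Literature.NumberTheory.Automorphic.GLTwoAdelicTorus
import Literature.NumberTheory.Automorphic.QuaternionUnitsTraceNormalized
import HarnessLib

/-!
# The elliptic terms of the `GL(2)` trace formula, one class at a time, with the printed constant
(Gelbart, *Automorphic forms on adele groups* (1975), Cor. 9.24 / (10.15):
`meas(Z_𝔸 G(γ)_F \ G(γ)_𝔸) ∫_{G(γ)_𝔸 \ G_𝔸} Φ(x⁻¹ γ x) dx` for `γ` elliptic; (9.13) and
Remark 9.23 for the unfolding)

Topic `NumberTheory/Automorphic`; theorems only (no definition, no named fact, no instance). The
`GL(2)` twin of the one-class part of `QuaternionUnitsTraceNormalized`: there the geometric side of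
the trace formula for the *compact* quotient `D_𝔸ˣ ⧸ ℝ_{>0} Dˣ` was unfolded class by class; on
the *non-compact* quotient `X = GL₂(𝔸_K) ⧸ ℝ_{>0} GL₂(K)` the same unfolding is valid **for the
elliptic classes** (and only for those: the volume factor `vol(G_γ ⧸ H_γ)` of a hyperbolic or
unipotent class is infinite), because the abstract one-class identity
`Literature.MeasureTheory.Group.lintegral_conjTsum_conjOrbit_eq_covol_mul` (`InvariantQuotientNormalized`)
needs compactness of `G_γ ⧸ (ℝ_{>0} GL₂(K) ∩ G_γ)` for the class in question — which for an elliptic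
`γ` is `compactSpace_glTwo_centralizer_quotient` (`GLTwoAdelicTorus`: `G_γ ≅ E_𝔸ˣ`, Fujisaki for
`E = K(γ)`) — and nothing about `X`.

For `𝒢 = AdelicGroupData.gl 2 K` (`G = GL₂(𝔸_K)`, `Γ = GL₂(K)`, `L = ℝ_{>0} GL₂(K)`), an elliptic
`γ ∈ GL₂(K)` (irreducible characteristic polynomial), `G_γ = C_G(γ)` (closed, abelian: the torus
`E_𝔸ˣ`), `H_γ = L ∩ G_γ`:

* `glTwo_isMulRightInvariant_centralizer`, `glTwo_isInvInvariant_centralizer` — every Haar measure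
  on `G_γ` is two-sided and inversion invariant (`G_γ` is abelian, `glTwo_adelic_centralizer_comm`);
* `glTwo_lintegral_conjTsum_conjOrbit_eq_covol_mul` — **the elliptic term of `γ` with the printed
  constant**: for an automorphic measure `μ` on `X`, a two-sided Haar measure `ν` on `G`, Haar
  measures `ρ_L` on `L`, `ν_γ` on `G_γ`, `ρ_H = ρ_L|_{H_γ}` and its transport `ρ_F` to `H_γ ≤ G_γ`,
  and Borel `F : G → [0, ∞]`,

    `∫_X Σ'_{s ∈ [γ]} F(x̃ s x̃⁻¹) dμ(x) = c_μ · vol(G_γ ⧸ H_γ) · ∫_{G ⧸ G_γ} F(y γ y⁻¹) d(ν/ν_γ)(y)`,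

  with `c_μ = unfoldingConstant L ρ_L μ ν`, `ν/ν_γ = quotientMeasure G_γ ν_γ ν` (Weil constant
  one) and `vol(G_γ ⧸ H_γ)` the total mass of `quotientMeasure (H_γ ⊓ G_γ) ρ_F ν_γ` — Gelbart's
  `meas(Z_𝔸 G(γ)_F \ G(γ)_𝔸)` for the measures `ν_γ` and `ρ_L|_{H_γ}` (finite:
  `compactSpace_glTwo_centralizer_quotient`); as on the `D^×` side it equals the covolume of
  `ℝ_{>0} Eˣ` in `E_𝔸ˣ` (`GLTwoTorusVolume`, `QuaternionGLTwoTorusComparison`);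
* `glTwo_exists_restricted_haar` — non-vacuity of the parameters `ρ_H`, `ρ_F` for the Haar measure
  `ρ_L = ((a, δ) ↦ a δ)_* (α ⊗ counting)` of `L ≅ ℝ_{>0} × GL₂(K)`;
* `glTwo_ellipticTerm_hypotheses` — the instance binders hold (`locallyCompactSpace_gl_adelic_holds`,
  `secondCountableTopology_gl_adelic`, `t2Space_gl`, `isClosed_quotientSubgroup_gl_holds`,
  `isClosed_centralizer_singleton`).

A brick of the inline (D-0026) decomposition of
`Literature.NumberTheory.Automorphic.strong_multiplicity_one_quaternionUnits` (Gelbart Thm. 10.5):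
the elliptic part of the geometric side of (10.15), to be compared with (10.14) term by term
(classes: `QuaternionGLTwoClasses*`; volumes: `QuaternionGLTwoTorusComparison`).

## References

* S. Gelbart, *Automorphic forms on adele groups*, Ann. of Math. Studies 83 (1975), (9.13),
  Remark 9.23, Cor. 9.24, (10.15) [Gelbart1975].
* H. Jacquet, R. P. Langlands, *Automorphic forms on GL(2)*, LNM 114 (1970), §16
  [JacquetLanglands1970].
-/

noncomputable section

open scoped NNReal ENNReal
open NumberField IsDedekindDomain MeasureTheory Measure Topology Matrix
open Literature.MeasureTheory.Group

namespace Literature.NumberTheory.Automorphic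

-- the coset spaces carry Borel σ-algebras supplied locally, not the quotient σ-algebra
attribute [-instance] Quotient.instMeasurableSpace QuotientGroup.measurableSpace

section Elliptic

variable (K : Type) [Field K] [NumberField K] (γ : GL (Fin 2) K)

/-- The adelic group datum of `GL₂`. -/
local notation "G2" => AdelicGroupData.gl 2 K

/-- `G_γ = C_{GL₂(𝔸_K)}(γ)` (spelled `AdelicGroupData.toAdelic G2 γ`, i.e. `(G2).toAdelic γ`). -/
local notation "Cg" => Subgroup.centralizer ({AdelicGroupData.toAdelic (AdelicGroupData.gl 2 K) γ} :
  Set (AdelicGroupData.Adelic (AdelicGroupData.gl 2 K)))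

/-- `GL₂(K)`, a number field being countable, is countable; hence so is its image in `GL₂(𝔸_K)`.
[folklore] -/
theorem countable_arithmeticSubgroup_glTwo : Countable (G2).arithmeticSubgroup := by
  haveI : Countable K := countable_numberField K
  haveI : Countable (Matrix (Fin 2) (Fin 2) K) := inferInstanceAs (Countable (Fin 2 → Fin 2 → K))
  haveI : Countable (GL (Fin 2) K) :=
    Function.Injective.countable (f := fun g : GL (Fin 2) K => ((g : Matrix (Fin 2) (Fin 2) K),
      ((g⁻¹ : GL (Fin 2) K) : Matrix (Fin 2) (Fin 2) K))) fun a b h => Units.ext (Prod.mk.inj h).1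
  haveI : Countable (G2).Rational := ‹Countable (GL (Fin 2) K)›
  exact Function.Surjective.countable (AdelicGroupData.gl 2 K).toAdelic.rangeRestrict_surjective

/-! ### Haar measures on the torus `G_γ` -/

/-- **Every Haar measure on `G_γ = C_{GL₂(𝔸_K)}(γ)` is right invariant** for a non-scalar
`γ ∈ GL₂(K)`: the centraliser is abelian (`glTwo_adelic_centralizer_comm`, the torus `E_𝔸ˣ`).
(Gelbart (1975), (10.15): the measures on `G(γ)_𝔸` are Haar measures of unimodular groups.)
[cite: Gelbart1975, (10.15)] -/
theorem glTwo_isMulRightInvariant_centralizer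
    (hγ : (γ : Matrix (Fin 2) (Fin 2) K) ∉ (⊥ : Subalgebra K (Matrix (Fin 2) (Fin 2) K)))
    [MeasurableSpace (G2).Adelic] (ν₀ : Measure Cg) [IsHaarMeasure ν₀] : ν₀.IsMulRightInvariant :=
  isMulRightInvariant_of_comm (Cg) (glTwo_adelic_centralizer_comm K γ hγ) ν₀

/-- **Every Haar measure on `G_γ`, `γ ∈ GL₂(K)` non-scalar, is inversion invariant** (right
invariant, and `G_γ` is a closed subgroup of the second countable locally compact `GL₂(𝔸_K)`,
`isInvInvariant_of_isMulRightInvariant`). [cite: Gelbart1975, (10.15)] -/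
theorem glTwo_isInvInvariant_centralizer
    (hγ : (γ : Matrix (Fin 2) (Fin 2) K) ∉ (⊥ : Subalgebra K (Matrix (Fin 2) (Fin 2) K)))
    [MeasurableSpace (G2).Adelic] [BorelSpace (G2).Adelic]
    (ν₀ : Measure Cg) [IsHaarMeasure ν₀] : ν₀.IsInvInvariant := by
  haveI : LocallyCompactSpace (G2).Adelic := AdelicGroupData.locallyCompactSpace_gl_adelic_holds 2 K
  haveI : SecondCountableTopology (G2).Adelic := secondCountableTopology_gl_adelic 2 K
  haveI : T2Space (G2).Adelic := t2Space_gl 2 K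
  haveI : IsClosed ((Cg : Subgroup (G2).Adelic) : Set (G2).Adelic) := isClosed_centralizer_singleton _
  haveI := glTwo_isMulRightInvariant_centralizer K γ hγ ν₀
  exact isInvInvariant_of_isMulRightInvariant ν₀

/-! ### The elliptic term of one class -/

attribute [local instance] AdelicGroupData.measurableSpaceQuotientForm
  AdelicGroupData.borelSpaceQuotientForm AdelicGroupData.smulInvariantMeasureQuotientForm
  AdelicGroupData.isFiniteMeasureOnCompactsQuotientForm AdelicGroupData.isFiniteMeasureQuotientForm

/-- **The elliptic term of the `GL(2)` trace formula for one class, with the printed constant**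
(Gelbart (1975), Cor. 9.24 and (10.15): the summand `meas(Z_𝔸 G(γ)_F \ G(γ)_𝔸) ∫_{G(γ)_𝔸 \ G_𝔸}
Φ(x⁻¹ γ x) dx` of an elliptic `γ`; unfolding (9.13)). Let `𝒢 = AdelicGroupData.gl 2 K`
(`G = GL₂(𝔸_K)`, `Γ = GL₂(K)`, `L = ℝ_{>0} GL₂(K)`, `X = G ⧸ L` — *not* compact), `γ ∈ GL₂(K)`
elliptic (irreducible characteristic polynomial), `G_γ = C_G(γ)` (closed; the torus `E_𝔸ˣ`),
`H_γ = L ∩ G_γ`; `μ` an automorphic measure on `X`, `ν` a two-sided Haar measure on `G`, `ρ_L` a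
Haar measure on `L`, `ν_γ` a Haar measure on `G_γ` (two-sided and inversion invariant,
`glTwo_isMulRightInvariant_centralizer`, `glTwo_isInvInvariant_centralizer`), `ρ_H = ρ_L|_{H_γ}`
(`Measure.comap` along `H_γ ↪ L`) and `ρ_F` its transport to `H_γ ≤ G_γ`. Then for Borel
`F : G → [0, ∞]`:

  `∫_X Σ'_{s ∈ [γ]} F(x̃ s x̃⁻¹) dμ(x) = c_μ · vol(G_γ ⧸ H_γ) · ∫_{G ⧸ G_γ} F(y γ y⁻¹) d(ν/ν_γ)(y)`,

`[γ]` the `GL₂(K)`-conjugacy class of `γ` in `G`, `c_μ = unfoldingConstant L ρ_L μ ν`,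
`ν/ν_γ = quotientMeasure G_γ ν_γ ν` and `vol(G_γ ⧸ H_γ)` the (finite) total mass of
`quotientMeasure (H_γ ⊓ G_γ) ρ_F ν_γ` — `meas(Z_𝔸 G(γ)_F \ G(γ)_𝔸)`. The compactness input is
`compactSpace_glTwo_centralizer_quotient`; the relative openness of `H_γ` in `L` comes from the
central retraction of `GL₂(𝔸_K)` and the discreteness of `GL₂(K)`. The instance binders hold by
`glTwo_ellipticTerm_hypotheses`. [cite: Gelbart1975, Cor. 9.24 and (10.15)] -/
theorem glTwo_lintegral_conjTsum_conjOrbit_eq_covol_mul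
    (hγ : Irreducible (γ : Matrix (Fin 2) (Fin 2) K).charpoly)
    [MeasurableSpace (G2).Adelic] [BorelSpace (G2).Adelic]
    [LocallyCompactSpace (G2).Adelic] [SecondCountableTopology (G2).Adelic] [T2Space (G2).Adelic]
    [hH : IsClosed ((G2).quotientSubgroup : Set (G2).Adelic)]
    [hCcl : IsClosed ((Cg : Subgroup (G2).Adelic) : Set (G2).Adelic)]
    [MeasurableSpace ((G2).Adelic ⧸ Cg)] [BorelSpace ((G2).Adelic ⧸ Cg)]
    [MeasurableSpace (↥Cg ⧸ ((G2).quotientSubgroup ⊓ Cg).subgroupOf Cg)]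
    [BorelSpace (↥Cg ⧸ ((G2).quotientSubgroup ⊓ Cg).subgroupOf Cg)]
    (μ : Measure (G2).automorphicQuotient) [(G2).IsAutomorphicMeasure μ]
    (ν : Measure (G2).Adelic) [IsHaarMeasure ν] [ν.IsMulRightInvariant]
    (ρL : Measure (G2).quotientSubgroup) [ρL.IsHaarMeasure] [SFinite ρL]
    (ρH : Measure ↥((G2).quotientSubgroup ⊓ Cg)) [IsHaarMeasure ρH] [ρH.IsInvInvariant] [SFinite ρH]
    (ρF : Measure ↥(((G2).quotientSubgroup ⊓ Cg).subgroupOf Cg))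
    [IsHaarMeasure ρF] [ρF.IsInvInvariant] [SFinite ρF]
    (νC : Measure Cg) [IsHaarMeasure νC] [νC.IsMulRightInvariant] [νC.IsInvInvariant] [SFinite νC]
    (hρH : ρH = ρL.comap (Subgroup.inclusion inf_le_left))
    (hρF : ρF = Measure.map (Subgroup.subgroupOfEquivOfLe inf_le_right).symm ρH)
    {F : (G2).Adelic → ℝ≥0∞} (hF : Measurable F) :
    ∫⁻ x, conjTsum (G2).quotientSubgroup (conjOrbit (G2).arithmeticSubgroup ((G2).toAdelic γ))
        (conj_mem_conjOrbit_of_exists (G2).arithmeticSubgroup (G2).quotientSubgroup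
          (AdelicGroupData.exists_inv_mul_mem_centralizer_quotientSubgroup (G2)) ⟨γ, rfl⟩) F x ∂μ =
      unfoldingConstant (G2).quotientSubgroup ρL μ ν *
        quotientMeasure (((G2).quotientSubgroup ⊓ Cg).subgroupOf Cg) ρF
            (isClosed_subgroupOf _ _ (hH.inter hCcl)) νC Set.univ *
          ∫⁻ y, descConj ((G2).toAdelic γ) Cg (mem_centralizer_singleton_comm _) F y
            ∂quotientMeasure Cg νC hCcl ν := by
  haveI : Countable (G2).arithmeticSubgroup := countable_arithmeticSubgroup_glTwo K
  have hdisc : (G2).IsDiscreteRational := gl_isDiscreteRational_holds 2 K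
  obtain ⟨θ, hθc, hθA, hθa, hθγ⟩ := exists_centralRetraction_gl 2 K
  haveI : IsClosed ((((G2).quotientSubgroup ⊓ Cg) : Subgroup (G2).Adelic) : Set (G2).Adelic) :=
    hH.inter hCcl
  haveI : CompactSpace (↥Cg ⧸ ((G2).quotientSubgroup ⊓ Cg).subgroupOf Cg) :=
    compactSpace_glTwo_centralizer_quotient K γ hγ
  have hopen : IsOpen (((((G2).quotientSubgroup ⊓ Cg).subgroupOf (G2).quotientSubgroup :
      Subgroup (G2).quotientSubgroup)) : Set (G2).quotientSubgroup) :=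
    AdelicGroupData.isOpen_subgroupOf_quotientSubgroup_of_center'_le (G2) hdisc θ hθc hθA hθa hθγ
      (AdelicGroupData.center'_le_inf_centralizer (G2) _)
  exact Literature.MeasureTheory.Group.lintegral_conjTsum_conjOrbit_eq_covol_mul
    (Γ := (G2).arithmeticSubgroup) (L := (G2).quotientSubgroup)
    (hΓL := (G2).arithmeticSubgroup_le_quotientSubgroup)
    (hLΓ := AdelicGroupData.exists_inv_mul_mem_centralizer_quotientSubgroup (G2))
    (hγ₀ := ⟨γ, rfl⟩) (H₀ := (G2).quotientSubgroup ⊓ Cg) (G₀ := Cg)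
    (hH₀ := fun g => mem_inf_centralizer_singleton_iff _ _ _) (hHG := inf_le_right)
    (hG₀ := mem_centralizer_singleton_comm _) (μ := μ) (ν := ν) (ρL := ρL) (ρH := ρH) (ρF := ρF)
    (ν₀ := νC) (hopen := hopen) (hμ := AdelicGroupData.IsAutomorphicMeasure.ne_zero (G2) μ)
    (hρH := hρH) (hρF := hρF) (hF := hF)

/-- **The restricted Haar measures exist** (non-vacuity of the parameters `ρ_H`, `ρ_F`): for a Haar
measure `α` on `A_G = ℝ_{>0}` let `ρ_L = ((a, δ) ↦ a δ)_* (α ⊗ counting)`, a Haar measure of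
`L = ℝ_{>0} GL₂(K)`; its restriction `ρ_H` to `H_γ = L ∩ G_γ` (relatively open in `L`) is a Haar
measure of `H_γ`, inversion invariant and s-finite, and so is its transport `ρ_F` to `H_γ ≤ G_γ`
(`isHaarMeasure_comap_subgroupInclusion`, `isInvInvariant_comap`, `isInvInvariant_map_mulEquiv`).
[folklore] -/
theorem glTwo_exists_restricted_haar
    [MeasurableSpace (G2).Adelic] [BorelSpace (G2).Adelic]
    [LocallyCompactSpace (G2).Adelic] [SecondCountableTopology (G2).Adelic] [T2Space (G2).Adelic]
    [hH : IsClosed ((G2).quotientSubgroup : Set (G2).Adelic)]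
    [hCcl : IsClosed ((Cg : Subgroup (G2).Adelic) : Set (G2).Adelic)]
    (α : Measure (G2).center') [α.IsHaarMeasure] [SFinite α] :
    ∃ (ρH : Measure ↥((G2).quotientSubgroup ⊓ Cg))
      (ρF : Measure ↥(((G2).quotientSubgroup ⊓ Cg).subgroupOf Cg)),
      IsHaarMeasure ρH ∧ ρH.IsInvInvariant ∧ SFinite ρH ∧
      IsHaarMeasure ρF ∧ ρF.IsInvInvariant ∧ SFinite ρF ∧
      ρH = (Measure.map (fun p : (G2).center' × (G2).arithmeticSubgroup =>
        (⟨(p.1 : (G2).Adelic) * p.2, AdelicGroupData.mulMap_mem (G2) p⟩ : (G2).quotientSubgroup))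
          (α.prod count)).comap (Subgroup.inclusion inf_le_left) ∧
      ρF = Measure.map (Subgroup.subgroupOfEquivOfLe inf_le_right).symm ρH := by
  haveI : Countable (G2).arithmeticSubgroup := countable_arithmeticSubgroup_glTwo K
  have hdisc : (G2).IsDiscreteRational := gl_isDiscreteRational_holds 2 K
  obtain ⟨θ, hθc, hθA, hθa, hθγ⟩ := exists_centralRetraction_gl 2 K
  set ρ₀ : Measure (G2).quotientSubgroup := Measure.map
    (fun p : (G2).center' × (G2).arithmeticSubgroup =>
      (⟨(p.1 : (G2).Adelic) * p.2, AdelicGroupData.mulMap_mem (G2) p⟩ : (G2).quotientSubgroup))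
    (α.prod count) with hρ₀
  haveI : ρ₀.IsHaarMeasure :=
    AdelicGroupData.isHaarMeasure_map_mul_prod_count (G2) hdisc θ hθc hθA hθa hθγ α
  haveI : ρ₀.IsMulRightInvariant := AdelicGroupData.isMulRightInvariant_quotientSubgroup_gl 2 K ρ₀
  haveI : ρ₀.IsInvInvariant := isInvInvariant_of_isMulRightInvariant ρ₀
  haveI hHcl : IsClosed ((((G2).quotientSubgroup ⊓ Cg) : Subgroup (G2).Adelic) : Set (G2).Adelic) :=
    hH.inter hCcl
  have hopen : IsOpen (((((G2).quotientSubgroup ⊓ Cg).subgroupOf (G2).quotientSubgroup :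
      Subgroup (G2).quotientSubgroup)) : Set (G2).quotientSubgroup) :=
    AdelicGroupData.isOpen_subgroupOf_quotientSubgroup_of_center'_le (G2) hdisc θ hθc hθA hθa hθγ
      (AdelicGroupData.center'_le_inf_centralizer (G2) _)
  set ρH : Measure ↥((G2).quotientSubgroup ⊓ Cg) := ρ₀.comap (Subgroup.inclusion inf_le_left) with hρH
  haveI hHa : IsHaarMeasure ρH := isHaarMeasure_comap_subgroupInclusion _ _ inf_le_left hopen ρ₀
  haveI hHi : ρH.IsInvInvariant :=
    isInvInvariant_comap (Subgroup.inclusion inf_le_left)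
      (measurableEmbedding_subgroupInclusion _ _ inf_le_left hHcl) ρ₀
  set ρF : Measure ↥(((G2).quotientSubgroup ⊓ Cg).subgroupOf Cg) :=
    Measure.map (Subgroup.subgroupOfEquivOfLe (inf_le_right : (G2).quotientSubgroup ⊓ Cg ≤ _)).symm ρH
    with hρF
  have hFa : IsHaarMeasure ρF :=
    MulEquiv.isHaarMeasure_map ρH _ (continuous_subgroupOfEquivOfLe_symm _ _ inf_le_right)
      (continuous_subgroupOfEquivOfLe _ _ inf_le_right)
  have hFi : ρF.IsInvInvariant :=
    isInvInvariant_map_mulEquiv _ (continuous_subgroupOfEquivOfLe_symm _ _ inf_le_right).measurable ρH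
  exact ⟨ρH, ρF, hHa, hHi, inferInstance, hFa, hFi, inferInstance, rfl, rfl⟩

/-- **The hypotheses of `glTwo_lintegral_conjTsum_conjOrbit_eq_covol_mul` hold**: `GL₂(𝔸_K)` is
locally compact, second countable and Hausdorff, `ℝ_{>0} GL₂(K)` and `G_γ` are closed.
[folklore] -/
theorem glTwo_ellipticTerm_hypotheses :
    LocallyCompactSpace (G2).Adelic ∧ SecondCountableTopology (G2).Adelic ∧ T2Space (G2).Adelic ∧
      IsClosed ((G2).quotientSubgroup : Set (G2).Adelic) ∧
      IsClosed ((Cg : Subgroup (G2).Adelic) : Set (G2).Adelic) := by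
  haveI : T2Space (G2).Adelic := t2Space_gl 2 K
  exact ⟨AdelicGroupData.locallyCompactSpace_gl_adelic_holds 2 K, secondCountableTopology_gl_adelic 2 K,
    inferInstance, isClosed_quotientSubgroup_gl_holds 2 K, isClosed_centralizer_singleton _⟩

end Elliptic

end Literature.NumberTheory.Automorphic
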